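import Summits.QuantumFields.YangMills.Theorems.BalabanLadderIROddTorusChessboard
import Summits.QuantumFields.YangMills.Theorems.SoloBlindExpMoment
import Mathlib.Data.Fintype.Pi
import HarnessLib

/-!
# Hereditary large-field rarity on the ODD torus: all cells of a prescribed family carry large action only with
# probability `δ ^ #cells`, volume-uniformly

Support file (seat ym-infvol-p3, fleet R136 (i); bears on crux `IR` = stmt-QuantumFields-19354, registered line
«af-pincer-T» clause (iii_T) of `TypShellCond` («torus anchor»: on every odd torus `2S+1 ≥ 4b` the periodic Wilson
state makes all cells of `F` atypical with probability `≤ δ ^ #F`) / line «hamming» clause (ii)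
`HereditaryRelayRarity`; count-neutral helper).

THE THEOREM (`measureReal_forall_le_cellAction_le_pow`).  Wilson theory of a compact `G`, continuous `ρ`, on the torus
`(ℤ/Lℤ)^d`, `L` ODD, `L ≥ 3`, coupling `β`, Chebyshev parameter `0 ≤ λ ≤ β`.  Let `(P_i)_{i ∈ F}` be finitely many
pairwise DISJOINT sets of plaquettes ("cells"), each with at most `n` plaquettes, and `T ∈ ℝ`.  Then

  `μ_{Λ,β} {U | ∀ i ∈ F, T ≤ ∑_{q ∈ P_i} φ_q(U)} ≤ (m · exp(-λT/m² + n Δ_Λ(λ) / (m L^d))) ^ #F`,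

`φ_q = N - Re tr ρ(U_q)`, `m = #orientations = d(d-1)/2`, `Δ_Λ(λ) = log Z_Λ(β-λ) - log Z_Λ(β) ≥ 0`.  Since
`Δ_Λ(λ)/L^d` is a free-energy-density difference, the base `δ` is UNIFORM IN THE VOLUME as soon as the free energy
density is (for `SU(2)`, `d = 4`: the tree's `WeakCouplingRates.su2_torusLogPartition_lower`,
`su2_torusLogPartition_nonpos` give `Δ_Λ(β/2)/L⁴ ≤ 48 + C log β`), and `δ → 0` as `β → ∞` at fixed cell size and fixed
threshold `T`.  HEREDITARY: the bound is a pure power of the base — exactly the shape of clause (iii_T) / (ii).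

Proof: pigeonhole over the `m` orientations inside each cell and a union bound over the `m^{#F}` assignments
`σ : F → orientations`; for one assignment, `μ(⋂_o E_o) ≤ (∏_o μ(E_o))^{1/m}` (trivially, `μ(⋂) ≤ μ(E_o)` for each `o`);
for one orientation, the exponential Chebyshev inequality and the ODD-TORUS CHESSBOARD
`wilsonExpectation_expObs_le_exp_card` (`…OddTorusChessboard`).

HONEST FRAMING: a finite-torus Peierls–chessboard rarity bound; it says nothing about decoupling, typical-data mixing
(clause (i_T)), the mass gap, or infinite volume.  References: Fröhlich–Israel–Lieb–Simon, CMP 62 (1978) Thm. 4.1 and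
§5 (Peierls–chessboard); Kotecký–Shlosman, CMP 83 (1982) (energy super-level events).
-/

noncomputable section

open MeasureTheory Finset
open Literature.MathematicalPhysics.QuantumFieldTheory Literature.MathematicalPhysics.QuantumLattice
open Literature.MathematicalPhysics.QuantumFieldTheory.WilsonRP
open Summit.QuantumFields.YangMills.Theorems.SoloBlind

namespace Summit.QuantumFields.YangMills.Theorems.OddTorusChessboard

variable {d L N : ℕ} [NeZero d] [NeZero L] {G : Type*} [Group G] [TopologicalSpace G]
  [IsTopologicalGroup G] [CompactSpace G] [MeasurableSpace G] [BorelSpace G]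
  (ρ : G →* Matrix (Fin N) (Fin N) ℂ)

/-! ### §1. Exponential Chebyshev inequality for the torus Wilson state -/

omit [NeZero d] in
/-- `μ{a ≤ X} ≤ e^{-a} ⟨e^{X}⟩` for a bounded measurable `X`. -/
theorem measureReal_le_exp_neg_mul_wilsonExpectation_exp (hρ : Continuous ρ) (β : ℝ) {X : GaugeConfig d L G → ℝ}
    (hXm : Measurable X) {C : ℝ} (hXb : ∀ U, |X U| ≤ C) (a : ℝ) :
    (wilsonMeasure ρ β).real {U | a ≤ X U} ≤ Real.exp (-a) * wilsonExpectation ρ β fun U => Real.exp (X U) := by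
  haveI := isProbabilityMeasure_wilsonMeasure (d := d) (L := L) (G := G) ρ hρ β
  have hSm : MeasurableSet {U : GaugeConfig d L G | a ≤ X U} := measurableSet_le measurable_const hXm
  have hint : Integrable (fun U : GaugeConfig d L G => Real.exp (-a) * Real.exp (X U)) (wilsonMeasure ρ β) := by
    refine (integrable_wilsonMeasure_of_abs_le ρ hρ β (X := fun U => Real.exp (X U))
      (Real.measurable_exp.comp hXm) (C := Real.exp C) fun U => ?_).const_mul _
    rw [Real.abs_exp]
    exact Real.exp_le_exp.2 ((le_abs_self _).trans (hXb U))
  unfold wilsonExpectation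
  rw [← integral_indicator_one hSm, ← integral_const_mul]
  refine integral_mono_of_nonneg (ae_of_all _ fun U => Set.indicator_nonneg (fun _ _ => zero_le_one) U) hint
    (ae_of_all _ fun U => ?_)
  show Set.indicator {U : GaugeConfig d L G | a ≤ X U} 1 U ≤ Real.exp (-a) * Real.exp (X U)
  by_cases hU : U ∈ {U : GaugeConfig d L G | a ≤ X U}
  · rw [Set.indicator_of_mem hU, Pi.one_apply, ← Real.exp_add]
    have ha : a ≤ X U := hU
    exact Real.one_le_exp (by linarith)
  · rw [Set.indicator_of_notMem hU]
    positivity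

/-! ### §2. One orientation: Chebyshev + the odd-torus chessboard -/

omit [NeZero d] [NeZero L] [TopologicalSpace G] [IsTopologicalGroup G] [CompactSpace G] [MeasurableSpace G]
  [BorelSpace G] in
/-- The part of a cell of orientation `o`. -/
theorem filter_orient_subset (P : Finset (Plaquette d L)) (o : Orient d) :
    P.filter (fun q => q.2 = o) ⊆ P := Finset.filter_subset _ _

/-- **One orientation.**  For pairwise disjoint cells `P_i` with at most `n` plaquettes each, `0 ≤ λ ≤ β`, `L` odd
`≥ 3`: `μ{∀ i ∈ F, T ≤ ∑_{q ∈ P_i, q of orientation o} φ_q} ≤ (exp(-λT) · exp(n Δ_Λ(λ)/L^d)) ^ #F`. -/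
theorem measureReal_forall_le_orientAction_le_pow (hL : Odd L) (hL3 : 3 ≤ L) (hρ : Continuous ρ) {β lam : ℝ}
    (hlam : 0 ≤ lam) (hlamβ : lam ≤ β) {ι : Type*} (F : Finset ι) (P : ι → Finset (Plaquette d L))
    (hdisj : ∀ i ∈ F, ∀ j ∈ F, i ≠ j → Disjoint (P i) (P j)) {n : ℕ} (hn : ∀ i ∈ F, #(P i) ≤ n)
    (o : Orient d) (T : ℝ) :
    (wilsonMeasure ρ β).real
        {U | ∀ i ∈ F, T ≤ ∑ q ∈ (P i).filter (fun q => q.2 = o), plaquetteCost ρ U q} ≤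
      (Real.exp (-(lam * T)) * Real.exp (n * ((torusLogPartition d ρ (β - lam) L - torusLogPartition d ρ β L) /
        (L : ℝ) ^ d))) ^ #F := by
  classical
  set Po : ι → Finset (Plaquette d L) := fun i => (P i).filter fun q => q.2 = o with hPo
  set Q : Finset (Plaquette d L) := F.biUnion Po with hQ
  set Δ : ℝ := torusLogPartition d ρ (β - lam) L - torusLogPartition d ρ β L with hΔ
  have hΔ0 : 0 ≤ Δ := SoloBlind.torusLogPartition_sub_nonneg (d := d) (L := L) (G := G) ρ hρ hlam
  have hdisjo : ∀ i ∈ F, ∀ j ∈ F, i ≠ j → Disjoint (Po i) (Po j) := fun i hi j hj hij =>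
    Finset.disjoint_of_subset_left (filter_orient_subset _ _)
      (Finset.disjoint_of_subset_right (filter_orient_subset _ _) (hdisj i hi j hj hij))
  have hQo : ∀ q ∈ Q, q.2 = o := fun q hq => by
    obtain ⟨i, -, hq⟩ := Finset.mem_biUnion.1 hq
    exact (Finset.mem_filter.1 hq).2
  have hQcard : (#Q : ℝ) ≤ n * #F := by
    have h1 : #Q ≤ ∑ i ∈ F, #(Po i) := Finset.card_biUnion_le
    have h2 : ∑ i ∈ F, #(Po i) ≤ ∑ _i ∈ F, n := Finset.sum_le_sum fun i hi =>
      (Finset.card_le_card (filter_orient_subset _ _)).trans (hn i hi)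
    rw [Finset.sum_const, smul_eq_mul] at h2
    have : (#Q : ℝ) ≤ ((#F * n : ℕ) : ℝ) := by exact_mod_cast h1.trans h2
    rw [Nat.cast_mul] at this
    linarith
  -- the event implies `λ T #F ≤ λ ∑_{q ∈ Q} φ_q`
  set X : GaugeConfig d L G → ℝ := fun U => lam * ∑ q ∈ Q, plaquetteCost ρ U q with hX
  have hsub : {U : GaugeConfig d L G | ∀ i ∈ F, T ≤ ∑ q ∈ Po i, plaquetteCost ρ U q} ⊆
      {U | lam * (T * #F) ≤ X U} := by
    intro U hU
    simp only [Set.mem_setOf_eq] at hU ⊢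
    rw [hX]
    refine mul_le_mul_of_nonneg_left ?_ hlam
    rw [hQ, Finset.sum_biUnion hdisjo]
    calc T * (#F : ℝ) = ∑ _i ∈ F, T := by rw [Finset.sum_const, nsmul_eq_mul, mul_comm]
      _ ≤ ∑ i ∈ F, ∑ q ∈ Po i, plaquetteCost ρ U q := Finset.sum_le_sum fun i hi => hU i hi
  have hXm : Measurable X :=
    (Finset.measurable_sum _ fun q _ => measurable_const.sub (measurable_plaqRe ρ hρ q)).const_mul _
  have hXb : ∀ U, |X U| ≤ |lam| * (#Q * (2 * N)) := fun U => by
    rw [hX, abs_mul]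
    refine mul_le_mul_of_nonneg_left ?_ (abs_nonneg _)
    calc |∑ q ∈ Q, plaquetteCost ρ U q| ≤ ∑ q ∈ Q, |plaquetteCost ρ U q| := Finset.abs_sum_le_sum_abs _ _
      _ ≤ ∑ _q ∈ Q, (2 * (N : ℝ)) := Finset.sum_le_sum fun q _ => by
          have h := abs_plaqRe_le ρ hρ U q
          have hq : Literature.MathematicalPhysics.QuantumFieldTheory.plaquetteCost ρ U q = N - plaqRe ρ U q := rfl
          rw [hq]
          have := abs_le.1 h
          rw [abs_le]; constructor <;> linarith
      _ = #Q * (2 * N) := by rw [Finset.sum_const, nsmul_eq_mul]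
  haveI := isProbabilityMeasure_wilsonMeasure (d := d) (L := L) (G := G) ρ hρ β
  -- Chebyshev and the chessboard
  have hcheb := measureReal_le_exp_neg_mul_wilsonExpectation_exp ρ hρ β hXm hXb (lam * (T * #F))
  have hexp : (fun U : GaugeConfig d L G => Real.exp (X U)) = expObs ρ lam Q := by
    funext U; rfl
  rw [hexp] at hcheb
  have hchess := wilsonExpectation_expObs_le_exp_card (d := d) (L := L) (G := G) ρ hL hL3 hρ hlam hlamβ o Q hQo
  rw [← hΔ] at hchess
  calc (wilsonMeasure ρ β).real {U | ∀ i ∈ F, T ≤ ∑ q ∈ Po i, plaquetteCost ρ U q}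
      ≤ (wilsonMeasure ρ β).real {U | lam * (T * #F) ≤ X U} := measureReal_mono hsub
    _ ≤ Real.exp (-(lam * (T * #F))) * wilsonExpectation ρ β (expObs (G := G) ρ lam Q) := hcheb
    _ ≤ Real.exp (-(lam * (T * #F))) * Real.exp ((#Q : ℝ) / (L : ℝ) ^ d * Δ) :=
        mul_le_mul_of_nonneg_left hchess (Real.exp_pos _).le
    _ ≤ Real.exp (-(lam * (T * #F))) * Real.exp ((n * #F : ℝ) / (L : ℝ) ^ d * Δ) := by
        refine mul_le_mul_of_nonneg_left (Real.exp_le_exp.2 ?_) (Real.exp_pos _).le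
        exact mul_le_mul_of_nonneg_right (div_le_div_of_nonneg_right hQcard (by positivity)) hΔ0
    _ = (Real.exp (-(lam * T)) * Real.exp (n * (Δ / (L : ℝ) ^ d))) ^ #F := by
        rw [← Real.exp_add, ← Real.exp_add, ← Real.exp_nat_mul]
        congr 1
        ring

/-! ### §3. All orientations: pigeonhole, union bound, geometric mean -/

omit [NeZero d] [NeZero L] [TopologicalSpace G] [IsTopologicalGroup G] [CompactSpace G] [MeasurableSpace G]
  [BorelSpace G] in
/-- Pigeonhole over the orientations inside one cell: if the cell action is `≥ T` then some orientation carries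
`≥ T / m`. -/
theorem exists_orient_of_le_sum (hm : 0 < Fintype.card (Orient d)) (P : Finset (Plaquette d L))
    (U : GaugeConfig d L G) {T : ℝ} (hT : T ≤ ∑ q ∈ P, plaquetteCost ρ U q) :
    ∃ o : Orient d, T / Fintype.card (Orient d) ≤ ∑ q ∈ P.filter (fun q => q.2 = o), plaquetteCost ρ U q := by
  classical
  by_contra h
  push Not at h
  have hsplit : ∑ q ∈ P, plaquetteCost ρ U q = ∑ o : Orient d, ∑ q ∈ P.filter (fun q => q.2 = o), plaquetteCost ρ U q := by
    rw [← Finset.sum_fiberwise_of_maps_to (g := fun q : Plaquette d L => q.2) (t := Finset.univ) (fun _ _ => Finset.mem_univ _)]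
  have hlt : ∑ o : Orient d, ∑ q ∈ P.filter (fun q => q.2 = o), plaquetteCost ρ U q <
      ∑ _o : Orient d, T / Fintype.card (Orient d) := Finset.sum_lt_sum_of_nonempty
    (Finset.univ_nonempty_iff.2 (Fintype.card_pos_iff.1 hm)) fun o _ => h o
  rw [Finset.sum_const, Finset.card_univ, nsmul_eq_mul, mul_div_cancel₀ _ (by exact_mod_cast hm.ne')] at hlt
  linarith

/-- **Hereditary large-field rarity on the odd torus.**  `L` odd, `L ≥ 3`, continuous `ρ`, `0 ≤ λ ≤ β`; finitely many
pairwise disjoint cells `P_i` with at most `n` plaquettes each; `m = #orientations`; any threshold `T`.  Then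
`μ_{Λ,β}{∀ i ∈ F, T ≤ ∑_{q∈P_i} φ_q} ≤ (m · exp(-λT/m² + n Δ_Λ(λ)/(m L^d))) ^ #F`,
`Δ_Λ(λ) = log Z_Λ(β-λ) - log Z_Λ(β)`. -/
theorem measureReal_forall_le_cellAction_le_pow (hL : Odd L) (hL3 : 3 ≤ L) (hρ : Continuous ρ) {β lam : ℝ}
    (hlam : 0 ≤ lam) (hlamβ : lam ≤ β) {ι : Type*} (F : Finset ι) (P : ι → Finset (Plaquette d L))
    (hdisj : ∀ i ∈ F, ∀ j ∈ F, i ≠ j → Disjoint (P i) (P j)) {n : ℕ} (hn : ∀ i ∈ F, #(P i) ≤ n) (T : ℝ)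
    (hm : 0 < Fintype.card (Orient d)) :
    (wilsonMeasure ρ β).real {U | ∀ i ∈ F, T ≤ ∑ q ∈ P i, plaquetteCost ρ U q} ≤
      ((Fintype.card (Orient d) : ℝ) * Real.exp (-(lam * T) / (Fintype.card (Orient d) : ℝ) ^ 2 +
        n * ((torusLogPartition d ρ (β - lam) L - torusLogPartition d ρ β L) / (L : ℝ) ^ d) /
          Fintype.card (Orient d))) ^ #F := by
  classical
  haveI := isProbabilityMeasure_wilsonMeasure (d := d) (L := L) (G := G) ρ hρ β
  set m : ℕ := Fintype.card (Orient d) with hmdef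
  set Δ : ℝ := torusLogPartition d ρ (β - lam) L - torusLogPartition d ρ β L with hΔ
  set μ := wilsonMeasure (d := d) (L := L) (G := G) ρ β with hμ
  have hm0 : (0 : ℝ) < m := by exact_mod_cast hm
  -- the events of one assignment `σ : F → orientations`
  set E : (F → Orient d) → Orient d → Set (GaugeConfig d L G) := fun σ o =>
    {U | ∀ i ∈ F.attach.filter (fun i => σ i = o), T / m ≤
      ∑ q ∈ (P i.1).filter (fun q => q.2 = o), plaquetteCost ρ U q} with hE
  -- pigeonhole: the event is covered by the union over `σ` of the intersections over `o`
  have hcover : {U : GaugeConfig d L G | ∀ i ∈ F, T ≤ ∑ q ∈ P i, plaquetteCost ρ U q} ⊆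
      ⋃ σ : F → Orient d, ⋂ o : Orient d, E σ o := by
    intro U hU
    simp only [Set.mem_setOf_eq] at hU
    have hch : ∀ i : F, ∃ o : Orient d, T / m ≤ ∑ q ∈ (P i.1).filter (fun q => q.2 = o), plaquetteCost ρ U q :=
      fun i => exists_orient_of_le_sum ρ hm (P i.1) U (hU i.1 i.2)
    choose σ hσ using hch
    refine Set.mem_iUnion.2 ⟨σ, Set.mem_iInter.2 fun o => ?_⟩
    simp only [hE, Set.mem_setOf_eq, Finset.mem_filter, Finset.mem_attach, true_and]
    intro i hi
    rw [← hi]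
    exact hσ i
  -- one assignment, one orientation: the single-orientation bound on the cells `{i | σ i = o}`
  set δ₁ : ℝ := Real.exp (-(lam * (T / m))) * Real.exp (n * (Δ / (L : ℝ) ^ d)) with hδ₁
  have hδ₁0 : 0 ≤ δ₁ := mul_nonneg (Real.exp_pos _).le (Real.exp_pos _).le
  have hone : ∀ (σ : F → Orient d) (o : Orient d),
      μ.real (E σ o) ≤ δ₁ ^ #(F.attach.filter fun i => σ i = o) := by
    intro σ o
    have h := measureReal_forall_le_orientAction_le_pow (d := d) (L := L) (G := G) ρ hL hL3 hρ hlam hlamβ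
      (F.attach.filter fun i => σ i = o) (fun i : F => P i.1)
      (fun i _ j _ hij => hdisj i.1 i.2 j.1 j.2 fun h => hij (Subtype.ext h)) (n := n)
      (fun i _ => hn i.1 i.2) o (T / m)
    exact h
  -- one assignment: geometric mean of the `m` single-orientation bounds
  have hcardsum : ∀ σ : F → Orient d, ∑ o : Orient d, #(F.attach.filter fun i => σ i = o) = #F := by
    intro σ
    rw [← Finset.card_attach (s := F)]
    exact (Finset.card_eq_sum_card_fiberwise (f := σ) (s := F.attach) (t := Finset.univ)
      fun _ _ => Finset.mem_coe.2 (Finset.mem_univ _)).symm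
  have hinter : ∀ σ : F → Orient d, μ.real (⋂ o : Orient d, E σ o) ≤ Real.exp (((-(lam * (T / m))) +
      n * (Δ / (L : ℝ) ^ d)) * #F / m) := by
    intro σ
    set x := μ.real (⋂ o : Orient d, E σ o) with hx
    have hx0 : 0 ≤ x := measureReal_nonneg
    have hxle : ∀ o, x ≤ δ₁ ^ #(F.attach.filter fun i => σ i = o) := fun o =>
      (measureReal_mono (Set.iInter_subset _ o)).trans (hone σ o)
    have hpow : x ^ m ≤ ∏ o : Orient d, δ₁ ^ #(F.attach.filter fun i => σ i = o) := by
      rw [hmdef, ← Finset.card_univ, ← Finset.prod_const]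
      exact Finset.prod_le_prod (fun _ _ => hx0) fun o _ => hxle o
    rw [Finset.prod_pow_eq_pow_sum, hcardsum σ] at hpow
    have hδexp : δ₁ ^ #F = Real.exp (((-(lam * (T / m))) + n * (Δ / (L : ℝ) ^ d)) * #F) := by
      rw [hδ₁, ← Real.exp_add, ← Real.exp_nat_mul]; congr 1; ring
    have hy : Real.exp (((-(lam * (T / m))) + n * (Δ / (L : ℝ) ^ d)) * #F / m) ^ m =
        Real.exp (((-(lam * (T / m))) + n * (Δ / (L : ℝ) ^ d)) * #F) := by
      rw [← Real.exp_nat_mul]; congr 1; field_simp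
    rw [hδexp, ← hy] at hpow
    exact le_of_pow_le_pow_left₀ hm.ne' (Real.exp_pos _).le hpow
  -- union bound over the `m ^ #F` assignments
  have hmeasE : ∀ σ o, MeasurableSet (E σ o) := by
    intro σ o
    simp only [hE, Set.setOf_forall]
    refine MeasurableSet.iInter fun i => MeasurableSet.iInter fun _ => ?_
    exact measurableSet_le measurable_const
      (Finset.measurable_sum _ fun q _ => measurable_const.sub (measurable_plaqRe ρ hρ q))
  calc μ.real {U | ∀ i ∈ F, T ≤ ∑ q ∈ P i, plaquetteCost ρ U q}
      ≤ μ.real (⋃ σ : F → Orient d, ⋂ o : Orient d, E σ o) := measureReal_mono hcover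
    _ ≤ ∑ σ : F → Orient d, μ.real (⋂ o : Orient d, E σ o) := measureReal_iUnion_fintype_le _
    _ ≤ ∑ _σ : F → Orient d, Real.exp (((-(lam * (T / m))) + n * (Δ / (L : ℝ) ^ d)) * #F / m) :=
        Finset.sum_le_sum fun σ _ => hinter σ
    _ = ((m : ℝ) * Real.exp (-(lam * T) / (m : ℝ) ^ 2 + n * (Δ / (L : ℝ) ^ d) / m)) ^ #F := by
        rw [Finset.sum_const, Finset.card_univ, Fintype.card_fun, Fintype.card_coe, nsmul_eq_mul, Nat.cast_pow,
          mul_pow, ← Real.exp_nat_mul]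
        congr 2
        field_simp

end Summit.QuantumFields.YangMills.Theorems.OddTorusChessboard

end
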